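import Literature.NumberTheory.EllipticCurves.YanZhu2026.BDPMainConjectureAtTrivialCharacter
import Summits.BirchSwinnertonDyer.Rank1Residual.Partition.MainConjecturesIrreducibleBDPClass
import HarnessLib

/-!
# The (IMC∘BDP)ᵍ link of the irreducible rank-one rows at `p = 3` FROM A PUBLISHED FACT:
# Yan–Zhu 2026 Thm. 4.12 ∘ CGLS 2022 Thm. 5.1.3 — rows C16 (`r ≤ 1`) and C3-ordinary (EVERY `p ≥ 3`)
# of the partition now stand on NAMED LITERATURE FACTS ONLY (+ (irr_K), + `p ∤ ∏c_ℓ` in rank one)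

HONEST FRAMING (cell `b2b-bsdres`, run/shared/lean/b2b/bsd-rank1-residual/; page 1 of every file):
the goal is to DELETE the COMBINATION-SHAPED residual classes — to produce a Lean theorem "BSD_p
formula for every rank `≤ 1` curve in class `C`" assembled STRICTLY from published theorems — so
that the remainder becomes exactly the CONSTRUCTION-SHAPED classes, which are TYPED, not attempted;
this is not "finishing BSD". Every published theorem enters as one of the tree's existing named
Literature facts `(h : <Fact>)` (a `def … : Prop` vendored with its cite, D-0014; nothing asserted, no
new fact, no `sorry`). Unit `b2b-bsdres-lit-glue` (GLUE seat), gen 7; sized ask A12 of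
`HOME/b2b-bsdres-lit-glue/GLUE.md` §G6.4, companion of the new Literature fact
`YanZhu2026.thm412_thm513_generator_constantCoeff` (this gen) and the `p = 3` twin of gen 6's
`Partition/MainConjecturesIrreducibleBDP.lean` / `…IrreducibleBDPClass.lean` (Files G1/G2: BCS 2025
Thm. 1.2.4 (b), printed for `p > 3` under (sur)).

## What this file does

Gen 6 discharged the anticyclotomic main-conjecture link (IMC∘BDP)ᵍ `X11b.IMCWaldspurgerOnTreeGoodAt`
of the covered IRREDUCIBLE rank-one rows at every good ordinary `p > 3` with (sur) from
Burungale–Castella–Skinner 2025 Thm. 1.2.4 (b) ∘ CGLS 2022 Thm. 5.1.3; at `p = 3` the link stayed a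
TYPED binder (`hLA3` of `RowC3.bsdp_of_thm331_of_thm124b_of_columnMainConjectures`, `hLA` of
`RowC16.bsdp_of_yzThm49_of_thm331`, `hLAle3` of the all-primes capstone
`bsdp_of_covered_of_mainConjectures_allPrimes_of_thm331_of_thm124b`), its printed source — Yan–Zhu
2026 Thm. 4.12 (the BDP main conjecture at an ODD good ordinary prime, rationally under (irr_K),
integrally under (Im)) — not yet being a composite Literature fact. It now is
(`YanZhu2026/BDPMainConjectureAtTrivialCharacter.lean`), and this file feeds it through the SAME
kernel road as gen 6 (generator with non-zero constant term from Jetchev–Skinner–Wan 2017 Thm. 3.3.1;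
the σ-bridge `X11b.exists_involutive_comp_eq` + lit-cgls S13 `padicLogOrd_comp_eq_of_rank_one` between
the CGLS letter of the fact and the JSW letter of the binders):

* §1 `X11b.imcWaldspurgerOnTreeGoodAt_of_thm412` — the EQUALITY link (IMC∘BDP)ᵍ in the CGLS letter
  `IMCWaldspurgerOnTreeGoodAt p κ v̄ γ ι P` at every datum of the fact (`p ≥ 3` good ordinary, (Im),
  (irr_K), `K` with (Heeg)/(spl)/(disc), `p ∤ c_E`), GIVEN one generator with `𝓕(0) ≠ 0`;
* §2 `…_of_thm412_of_thm331` — the generator from JSW 3.3.1 at THE embedding `embAt v̄`;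
* §3 `X11b.imcWaldspurgerOnTreeGoodAt_inducedPlace_of_thm412_of_thm331` — the SAME link in the JSW
  letter `IMCWaldspurgerOnTreeGoodAt p κ (inducedPlace ι) γ ι P` (σ-bridge + S13);
* §4 at a classical Heegner datum of an `r_an = 1` curve (rank one and `#Ш(E/K)[p^∞] < ∞` over `K`
  by Kolyvagin from the non-torsion Heegner point): the `hLA`-shaped binders in BOTH letters,
  DISCHARGED at every odd good ordinary `p` with (Im) and (irr_K) — in particular at `p = 3`;
* §5 the class theorems with the `p = 3` binder GONE: **`RowC16.bsdp_of_yzThm49_of_thm331_of_thm412`**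
  (row C16, `r ≤ 1`: Yan–Zhu Thm. 4.9 [cyclotomic IMC, integral under (Im)] + Thm. 4.12 ∘ BDP
  [anticyclotomic IMC] + JSW 3.3.1 [control] + GZ + Kolyvagin + GZK + Greenberg 4.1 + modularity +
  Hoffstein–Luo/BFH + Mazur (Manin) + Néron scaling + Wuthrich L. 20 ((Im) at `3` from surj(3)) —
  EVERY input a named Literature fact; residual explicit binders `hIrrK` ((irr_K) at the Heegner
  fields, in print ⇐ surj(3) for the quadratic `K`, no tree bridge yet) and `htam0` (`3 ∤ ∏c_ℓ` in
  rank one, gen 3's STEP-L restriction)) — i.e. the printed proof of Yan–Zhu Thm. 4.15 at `p = 3`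
  ("the rank `0` `p`-part BSD formula comes from (the integral part of) Theorem 4.9 and descent
  arguments … the rank `1` `p`-part BSD formula comes from (the integral part of) Theorem 4.12 and
  descent arguments (see [JSW] for details)", §4.6) kernel-checked at statement level; and
  **`RowC3.bsdp_of_thm331_of_bdpFacts_of_columnMainConjectures`** (row C3 = JSW Thm. 1.2.1: the
  ORDINARY branch at EVERY prime of the row — `p ≥ 5` via BCS 1.2.4 (b), `p = 3` via Yan–Zhu 4.12 —
  from named facts + `hIrrK` + `htam0`; the supersingular branch unchanged: typed Kobayashi signed MC
  (OPEN in print off CM / `a_p = 0`) + BKO Cor. A.5).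

References: [YanZhu2024MainConjNonCM] Thm. 4.9, Conj. 4.10, Thm. 4.12, Thm. 4.15 and its proof (§4.6);
[CastellaGrossiLeeSkinner2022] Thm. 5.1.3; [JetchevSkinnerWan2017] Thm. 1.2.1, Thm. 3.3.1, §7.4.1;
[BurungaleCastellaSkinner2025] Thm. 1.1.2 (b), Thm. 1.2.4 (b), Cor. 1.3.1; [Wuthrich2014] Lemma 20;
the module docstrings of gen 6 Files G1/G2; HOME/b2b-bsdres-lit-glue/GLUE.md GEN 7 ADDENDUM.
-/

set_option autoImplicit false

noncomputable section

open scoped Classical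

open WeierstrassCurve NumberField IsDedekindDomain Literature.NumberTheory.EllipticCurves
  Literature.NumberTheory.EllipticCurves.ModularForms Literature.NumberTheory.Automorphic
  Literature.NumberTheory.EllipticCurves.Rank1Residual
  Literature.NumberTheory.EllipticCurves.YanZhu2026
  Literature.NumberTheory.EllipticCurves.BurungaleCastellaSkinner2025
  Literature.NumberTheory.EllipticCurves.BurungaleKobayashiOta2024
  Literature.NumberTheory.EllipticCurves.CastellaGrossiLeeSkinner2022
  Literature.NumberTheory.EllipticCurves.JetchevSkinnerWan2017
  Summit.BirchSwinnertonDyer.BirchSwinnertonDyer.Theorems.Rank1ResidualX1Defs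

namespace Summit.BirchSwinnertonDyer.Rank1Residual

namespace X11b

/-! ### §1 `IMCWaldspurgerOnTreeGoodAt` (CGLS letter) from the Yan–Zhu ∘ BDP fact, given a generator -/

section IMC

variable {W : WeierstrassCurve ℚ} [W.IsElliptic] [W.IsGloballyMinimal] {p : ℕ} [Fact p.Prime]
  {K : Type} [Field K] [NumberField K]

/-- **`X11b.IMCWaldspurgerOnTreeGoodAt p κ v̄ γ ι P` FROM Yan–Zhu 2026 Thm. 4.12 ∘ CGLS 2022
Thm. 5.1.3**, at every datum of the fact — `p ≥ 3` good ordinary with (Im), `K` imaginary quadratic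
with (Heeg) for `N = N_E`, (spl), (disc) `D_K` odd `≠ −3`, `ρ̄_E|_{G_K}` irreducible, `ι : K ↪ ℚ_p`
inducing `v`, `v̄ ∋ p` the other (STRICT) prime, `κ` anticyclotomic with generator `γ`, `P = P_K` the
Heegner point of `(Dt, H, ιC)` — for a parametrisation with `p ∤ c_E` (then the Manin term of the fact
vanishes and its valuation is LITERALLY the predicate's), GIVEN one generator `G` of `ch_Λ(𝒳_{𝓕_Gr})`
with `G(0) ≠ 0` (supplied by a control theorem, §2). Through the defeq bridge
(`AcSelmer.hasCharValuationAt_iff_literature`, `padicLogOrd_eq_literature`). The `p ≥ 3`/(Im) twin of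
gen 6's `imcWaldspurgerOnTreeGoodAt_of_thm124b`. [cite: YanZhu2024MainConjNonCM, Thm. 4.12 (§4.5, p. 11) and proof of Thm. 4.15 (§4.6, p. 12)]
[cite: CastellaGrossiLeeSkinner2022, Thm. 5.1.3] [cite: Castella2018, §5 (eq:IMC+BDP) (arXiv:1704.06608 p. 12)] -/
theorem imcWaldspurgerOnTreeGoodAt_of_thm412 (h412 : thm412_thm513_generator_constantCoeff)
    (hp : 3 ≤ p) (hord : GoodOrd W p) (him : BigIm W p) (hK : IsImaginaryQuadratic K)
    (hodd : Odd (NumberField.discr K)) (h3 : NumberField.discr K ≠ -3)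
    {N : ℕ} [NeZero N] (hN : W.conductorNorm ℤ = N) (hHN : SatisfiesHeegnerHypothesis N K)
    (hHp : SatisfiesHeegnerHypothesis p K) (hirrK : (W.baseChange K).HasIrreducibleModPGaloisRep p)
    (ι : K →+* ℚ_[p]) (v vbar : HeightOneSpectrum (𝓞 K))
    (hv : ∀ x : 𝓞 K, x ∈ v.asIdeal ↔ ‖ι (x : K)‖ < 1)
    (hvbar : ((p : ℕ) : 𝓞 K) ∈ vbar.asIdeal) (hne : vbar ≠ v)
    (κ : ZpExtension K p) (hκ : κ.IsAnticyclotomic)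
    (γ : Field.absoluteGaloisGroup K) [Fact (κ.IsTopGenerator γ)]
    (Dt : ModularParametrizationData W N) (hc : ¬ (p : ℤ) ∣ Dt.c)
    (H : HeegnerDatum N (NumberField.discr K)) (ιC : K →+* ℂ) (P : (W.baseChange K).toAffine.Point)
    (hP : WeierstrassCurve.Affine.Point.map ιC.toRatAlgHom P = heegnerPointComplex Dt H)
    (G : IwasawaAlgebra p)
    (hG : Literature.NumberTheory.EllipticCurves.Castella2018.AcSelmer.XAc.charIdeal (W.baseChange K) p
      κ vbar ∅ γ = Ideal.span {G})
    (hG0 : PowerSeries.constantCoeff G ≠ 0) :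
    IMCWaldspurgerOnTreeGoodAt p κ vbar γ ι P := by
  have hHN' : SatisfiesHeegnerHypothesis (W.conductorNorm ℤ) K := by rw [hN]; exact hHN
  obtain ⟨n, hn, hval⟩ := hasCharValuationAt_of_thm412 h412 hp hord him K hK hHN' hHp hodd h3 hirrK ι
    v vbar hv hvbar hne κ hκ γ Dt H ιC P hP G hG hG0
  have hc0 : padicValInt p Dt.c = 0 := padicValInt.eq_zero_of_not_dvd hc
  refine ⟨n, (AcSelmer.hasCharValuationAt_iff_literature _ p κ vbar ∅ γ n).mpr hn, ?_⟩
  rw [padicLogOrd_eq_literature]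
  omega

/-! ### §2 The generator from the published control theorem (JSW 3.3.1, `p ≥ 3`) -/

/-- **(IMC∘BDP)ᵍ, CGLS letter, from Yan–Zhu 4.12 ∘ CGLS 5.1.3 + JSW 3.3.1** — NO anomaly restriction,
every odd good ordinary `p` with (Im) and (irr_K): the generator with `𝓕(0) ≠ 0` of `ch_Λ(X_ac)` for
the module STRICT AT `v̄` comes from Jetchev–Skinner–Wan 2017 Thm. 3.3.1 (A174, `p ≥ 3`) applied at THE
embedding `embAt v̄ : K ↪ K_v̄ = ℚ_p` (which induces `v̄`: `mem_asIdeal_iff_norm_embAt_lt_one`; `v̄` has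
degree one as `p` splits); JSW's module does not depend on the embedding and its valuation formula is
not used here. (irr_K) is a hypothesis of BOTH facts. The twin of gen 6's
`imcWaldspurgerOnTreeGoodAt_of_thm124b_of_thm331`. [cite: YanZhu2024MainConjNonCM, Thm. 4.12]
[cite: CastellaGrossiLeeSkinner2022, Thm. 5.1.3] [cite: JetchevSkinnerWan2017, Thm. 3.3.1] -/
theorem imcWaldspurgerOnTreeGoodAt_of_thm412_of_thm331 (h412 : thm412_thm513_generator_constantCoeff)
    (h331 : thm331_anticyclotomicControl)
    (hp : 3 ≤ p) (hord : GoodOrd W p) (him : BigIm W p)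
    (hK : IsImaginaryQuadratic K) (hodd : Odd (NumberField.discr K)) (h3 : NumberField.discr K ≠ -3)
    {N : ℕ} [NeZero N] (hN : W.conductorNorm ℤ = N) (hHN : SatisfiesHeegnerHypothesis N K)
    (hHp : SatisfiesHeegnerHypothesis p K) (hirrK : (W.baseChange K).HasIrreducibleModPGaloisRep p)
    (ι : K →+* ℚ_[p]) (v vbar : HeightOneSpectrum (𝓞 K))
    (hv : ∀ x : 𝓞 K, x ∈ v.asIdeal ↔ ‖ι (x : K)‖ < 1)
    (hvbar : ((p : ℕ) : 𝓞 K) ∈ vbar.asIdeal) (hne : vbar ≠ v)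
    (κ : ZpExtension K p) (hκ : κ.IsAnticyclotomic)
    (γ : Field.absoluteGaloisGroup K) [Fact (κ.IsTopGenerator γ)]
    (Dt : ModularParametrizationData W N) (hc : ¬ (p : ℤ) ∣ Dt.c)
    (H : HeegnerDatum N (NumberField.discr K)) (ιC : K →+* ℂ) (P : (W.baseChange K).toAffine.Point)
    (hP : WeierstrassCurve.Affine.Point.map ιC.toRatAlgHom P = heegnerPointComplex Dt H)
    (hrk : (W.baseChange K).mordellWeilRank = 1)
    (hfinp : Finite (AddCommGroup.primaryComponent (W.baseChange K).sha p))
    (hPinf : ¬ IsOfFinAddOrder P) :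
    IMCWaldspurgerOnTreeGoodAt p κ vbar γ ι P := by
  have hHN' : SatisfiesHeegnerHypothesis (W.conductorNorm ℤ) K := by rw [hN]; exact hHN
  -- `v̄` has degree one (`p` splits in the quadratic `K`), so `embAt v̄ : K ↪ ℚ_p` induces `v̄`
  have hsplit : SplitsIn K p := hHp p Fact.out (dvd_refl p)
  obtain ⟨he, hf⟩ := degreeOne_of_splitsIn hK.1 hsplit hvbar
  obtain ⟨-, F, hF, hF0, -⟩ := h331 W p hp hord.1 K hK hHp hHN' hirrK
    (embAt K p vbar hvbar he hf) vbar (mem_asIdeal_iff_norm_embAt_lt_one vbar hvbar he hf) κ hκ γ hrk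
    hfinp P hPinf
  exact imcWaldspurgerOnTreeGoodAt_of_thm412 h412 hp hord him hK hodd h3 hN hHN hHp hirrK ι v vbar hv
    hvbar hne κ hκ γ Dt hc H ιC P hP F hF hF0

/-! ### §3 The JSW letter: module strict at the induced prime, log along the same embedding -/

/-- **(IMC∘BDP)ᵍ in the JSW / Castella letter `IMCWaldspurgerOnTreeGoodAt p κ (inducedPlace ι) γ ι P`
from Yan–Zhu 4.12 ∘ CGLS 5.1.3 + JSW 3.3.1**, for EVERY embedding `ι : K ↪ ℚ_p`, in rank one, at
every odd good ordinary `p` with (Im) and (irr_K). Let `v = inducedPlace ι` and `w ≠ v` the other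
prime above `p` (`exists_other_prime`); Yan–Zhu ∘ BDP at the embedding `embAt w` (inducing `w`),
strict prime `v`, gives `ord_p 𝓖(0) = 2·(ord_p(1 − a_p + p) − 1 + ord_p log_{embAt w} P)` for every
generator `𝓖` of `ch_Λ(X_ac(κ, v))` with `𝓖(0) ≠ 0` — one exists by JSW 3.3.1 at `(ι, v)` —, and
`embAt w = ι ∘ σ` for an involution `σ` of `K` (`exists_involutive_comp_eq`), so `ord_p log_{embAt w}
P = ord_p log_ι P` (`padicLogOrd_comp_eq_of_rank_one`: `σ_* P = ±P + torsion` in rank one, `p ≠ 2`).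
The twin of gen 6's `imcWaldspurgerOnTreeGoodAt_inducedPlace_of_thm124b_of_thm331`.
[cite: YanZhu2024MainConjNonCM, Thm. 4.12 (§4.5, p. 11)] [cite: CastellaGrossiLeeSkinner2022, Thm. 5.1.3]
[cite: JetchevSkinnerWan2017, Thm. 3.3.1, §2.3.2 (p. 7)] [cite: Castella2018, Thm. 2.3, §5 (eq:IMC+BDP)] -/
theorem imcWaldspurgerOnTreeGoodAt_inducedPlace_of_thm412_of_thm331
    (h412 : thm412_thm513_generator_constantCoeff) (h331 : thm331_anticyclotomicControl)
    (hp : 3 ≤ p) (hord : GoodOrd W p) (him : BigIm W p)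
    (hK : IsImaginaryQuadratic K) (hodd : Odd (NumberField.discr K)) (h3 : NumberField.discr K ≠ -3)
    {N : ℕ} [NeZero N] (hN : W.conductorNorm ℤ = N) (hHN : SatisfiesHeegnerHypothesis N K)
    (hHp : SatisfiesHeegnerHypothesis p K) (hirrK : (W.baseChange K).HasIrreducibleModPGaloisRep p)
    (ι : K →+* ℚ_[p]) (κ : ZpExtension K p) (hκ : κ.IsAnticyclotomic)
    (γ : Field.absoluteGaloisGroup K) [Fact (κ.IsTopGenerator γ)]
    (Dt : ModularParametrizationData W N) (hc : ¬ (p : ℤ) ∣ Dt.c)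
    (H : HeegnerDatum N (NumberField.discr K)) (ιC : K →+* ℂ) (P : (W.baseChange K).toAffine.Point)
    (hP : WeierstrassCurve.Affine.Point.map ιC.toRatAlgHom P = heegnerPointComplex Dt H)
    (hrk : (W.baseChange K).mordellWeilRank = 1)
    (hfinp : Finite (AddCommGroup.primaryComponent (W.baseChange K).sha p))
    (hPinf : ¬ IsOfFinAddOrder P) :
    IMCWaldspurgerOnTreeGoodAt p κ (inducedPlace ι) γ ι P := by
  have hHN' : SatisfiesHeegnerHypothesis (W.conductorNorm ℤ) K := by rw [hN]; exact hHN
  -- the other prime `w` above `p`, of degree one, and THE embedding at it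
  obtain ⟨w, hw, hwne⟩ := exists_other_prime hHp (inducedPlace ι) (natCast_mem_inducedPlace ι)
  have hsplit : SplitsIn K p := hHp p Fact.out (dvd_refl p)
  obtain ⟨he, hf⟩ := degreeOne_of_splitsIn hK.1 hsplit hw
  set ιw : K →+* ℚ_[p] := embAt K p w hw he hf with hιw
  -- a generator with non-zero constant term of the module strict at `v = inducedPlace ι`, from JSW
  obtain ⟨-, F, hF, hF0, -⟩ := h331 W p hp hord.1 K hK hHp hHN' hirrK ι (inducedPlace ι)
    (mem_inducedPlace_iff ι) κ hκ γ hrk hfinp P hPinf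
  -- Yan–Zhu ∘ BDP at the embedding `ιw` (inducing `w`), strict prime `inducedPlace ι`
  obtain ⟨n, hn, hval⟩ := hasCharValuationAt_of_thm412 h412 hp hord him K hK hHN' hHp hodd h3 hirrK ιw w
    (inducedPlace ι) (mem_asIdeal_iff_norm_embAt_lt_one w hw he hf) (natCast_mem_inducedPlace ι)
    (fun h ↦ hwne h.symm) κ hκ γ Dt H ιC P hP F hF hF0
  -- `ιw = ι ∘ σ` for an involution `σ`; the log valuations agree in rank one
  obtain ⟨σ, hσ, hισ⟩ := exists_involutive_comp_eq hK.1 ι ιw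
  have hlog : Literature.NumberTheory.EllipticCurves.padicLogOrd W p ιw P = padicLogOrd W p ι P := by
    rw [← hισ, ← padicLogOrd_eq_literature]
    exact padicLogOrd_comp_eq_of_rank_one W p (by omega) σ hσ ι hrk P hPinf
  have hc0 : padicValInt p Dt.c = 0 := padicValInt.eq_zero_of_not_dvd hc
  refine ⟨n, (AcSelmer.hasCharValuationAt_iff_literature _ p κ (inducedPlace ι) ∅ γ n).mpr hn, ?_⟩
  rw [hlog] at hval
  omega

end IMC

/-! ### §4 The `hLA`-shaped binders at a classical Heegner datum, DISCHARGED at every odd `p` -/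

section Datum

variable (W : WeierstrassCurve ℚ) [W.IsElliptic] [W.IsGloballyMinimal] (p : ℕ) [Fact p.Prime]
  (N : ℕ) [NeZero N] (K : Type) [Field K] [NumberField K]
  (Dt : ModularParametrizationData W N) (H : HeegnerDatum N (NumberField.discr K)) (ιC : K →+* ℂ)
  (P : (W.baseChange K).toAffine.Point)

/-- **The CGLS-letter binder `IMCLowerWaldspurgerOnTreeGoodAt p κ v̄ γ ι P` (gen 5's `hLA`) at a
classical Heegner datum with `P_K` non-torsion, from Yan–Zhu 4.12 ∘ CGLS 5.1.3 + JSW 3.3.1** — every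
odd good ordinary `p` with (Im) and (irr_K), anomalous or not: `rank_ℤ E(K) = 1` and `#Ш(E/K) < ∞` by
Kolyvagin (`hKo`, from the non-torsion Heegner point); `d_K < −4` gives `d_K ≠ −3`.
[cite: YanZhu2024MainConjNonCM, Thm. 4.12, proof of Thm. 4.15 (§4.6)]
[cite: CastellaGrossiLeeSkinner2022, Thm. 5.1.3] [cite: JetchevSkinnerWan2017, Thm. 3.3.1] [cite: Kolyvagin1990, Thm. A] -/
theorem imcLowerWaldspurgerOnTreeGoodAt_of_heegner_of_thm412_of_thm331
    (h412 : thm412_thm513_generator_constantCoeff) (h331 : thm331_anticyclotomicControl)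
    (hKo : kolyvagin N W K)
    (hp : 3 ≤ p) (hord : GoodOrd W p) (him : BigIm W p)
    (hirrK : (W.baseChange K).HasIrreducibleModPGaloisRep p)
    (hN : W.conductorNorm ℤ = N) (hK : IsImaginaryQuadratic K)
    (hodd : Odd (NumberField.discr K)) (hlt : NumberField.discr K < -4)
    (hHN : SatisfiesHeegnerHypothesis N K) (hHp : SatisfiesHeegnerHypothesis p K)
    (hP : WeierstrassCurve.Affine.Point.map ιC.toRatAlgHom P = heegnerPointComplex Dt H)
    (hc : ¬ (p : ℤ) ∣ Dt.c) (hPinf : ¬ IsOfFinAddOrder P) {κ : ZpExtension K p} (hκ : κ.IsAnticyclotomic)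
    {γ : Field.absoluteGaloisGroup K} [Fact (κ.IsTopGenerator γ)] (ι : K →+* ℚ_[p])
    (vbar : HeightOneSpectrum (𝓞 K)) (hvbar : ((p : ℕ) : 𝓞 K) ∈ vbar.asIdeal)
    (hne : vbar ≠ inducedPlace ι) :
    IMCLowerWaldspurgerOnTreeGoodAt p κ vbar γ ι P := by
  obtain ⟨hrk, hsha⟩ := hKo hK hHN ⟨Dt, H, ιC, hP⟩ hPinf
  haveI : Finite (W.baseChange K).sha := hsha
  exact imcLowerWaldspurgerOnTreeGoodAt_of_imcWaldspurgerOnTreeGoodAt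
    (imcWaldspurgerOnTreeGoodAt_of_thm412_of_thm331 h412 h331 hp hord him hK hodd (by omega) hN hHN hHp
      hirrK ι (inducedPlace ι) vbar (mem_inducedPlace_iff ι) hvbar hne κ hκ γ Dt hc H ιC P hP hrk
      inferInstance hPinf)

/-- **The JSW-letter binder `IMCLowerWaldspurgerOnTreeGoodAt p κ (inducedPlace ι) γ ι P` (gen 6's
`hLA` / `hLA3` / `hLAle3`) at a classical Heegner datum with `P_K` non-torsion, from Yan–Zhu 4.12 ∘
CGLS 5.1.3 + JSW 3.3.1 + the σ-bridge** — every odd good ordinary `p` with (Im) and (irr_K), anomalous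
or not; rank one and finite `Ш` over `K` by Kolyvagin (`hKo`).
[cite: YanZhu2024MainConjNonCM, Thm. 4.12, proof of Thm. 4.15 (§4.6)]
[cite: JetchevSkinnerWan2017, Thm. 3.3.1, §7.4.1] [cite: Kolyvagin1990, Thm. A] -/
theorem imcLowerWaldspurgerOnTreeGoodAt_inducedPlace_of_heegner_of_thm412_of_thm331
    (h412 : thm412_thm513_generator_constantCoeff) (h331 : thm331_anticyclotomicControl)
    (hKo : kolyvagin N W K)
    (hp : 3 ≤ p) (hord : GoodOrd W p) (him : BigIm W p)
    (hirrK : (W.baseChange K).HasIrreducibleModPGaloisRep p)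
    (hN : W.conductorNorm ℤ = N) (hK : IsImaginaryQuadratic K)
    (hodd : Odd (NumberField.discr K)) (hlt : NumberField.discr K < -4)
    (hHN : SatisfiesHeegnerHypothesis N K) (hHp : SatisfiesHeegnerHypothesis p K)
    (hP : WeierstrassCurve.Affine.Point.map ιC.toRatAlgHom P = heegnerPointComplex Dt H)
    (hc : ¬ (p : ℤ) ∣ Dt.c) (hPinf : ¬ IsOfFinAddOrder P) {κ : ZpExtension K p} (hκ : κ.IsAnticyclotomic)
    {γ : Field.absoluteGaloisGroup K} [Fact (κ.IsTopGenerator γ)] (ι : K →+* ℚ_[p]) :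
    IMCLowerWaldspurgerOnTreeGoodAt p κ (inducedPlace ι) γ ι P := by
  obtain ⟨hrk, hsha⟩ := hKo hK hHN ⟨Dt, H, ιC, hP⟩ hPinf
  haveI : Finite (W.baseChange K).sha := hsha
  exact imcLowerWaldspurgerOnTreeGoodAt_of_imcWaldspurgerOnTreeGoodAt
    (imcWaldspurgerOnTreeGoodAt_inducedPlace_of_thm412_of_thm331 h412 h331 hp hord him hK hodd
      (by omega) hN hHN hHp hirrK ι κ hκ γ Dt hc H ιC P hP hrk inferInstance hPinf)

end Datum

end X11b

/-! ### §5 Rows C16 and C3 with BOTH anticyclotomic links published at `p = 3` -/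

section Rows

variable (W : WeierstrassCurve ℚ) [W.IsElliptic] [W.IsGloballyMinimal] (p : ℕ) [Fact p.Prime]

/-- **Row C16 (`r ≤ 1`: `p = 3` good ordinary, (irr), surj(3) ∨ ram(3)), anomalous or not, from
NAMED LITERATURE FACTS** (+ (irr_K) at the Heegner fields, + `3 ∤ ∏c_ℓ` in rank one): gen 6's
`RowC16.bsdp_of_yzThm49_of_thm331` with its last typed binder `hLA` DISCHARGED by Yan–Zhu 2026
Thm. 4.12 ∘ CGLS 2022 Thm. 5.1.3 (`h412`, §4; (Im) at `3` from surj(3) by Wuthrich 2014 Lemma 20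
`hW20`, ram(3) ⇒ surj(3) by `surj_of_irr_of_ram`). Inputs: Yan–Zhu Thm. 4.9 (`hYZ`, cyclotomic IMC,
integral under (Im)), JSW Thm. 3.3.1 (`h331`, control, `p ≥ 3`), `h412` (anticyclotomic IMC ∘ BDP),
Gross–Zagier, Kolyvagin, GZK, Greenberg 4.1, modularity, Hoffstein–Luo / BFH, Mazur (Manin), Néron
scaling, Wuthrich L. 20 — all named facts of the tree. This is the printed proof of Yan–Zhu Thm. 4.15
at `p = 3` (§4.6: "(the integral part of) Theorem 4.9 and descent arguments … (the integral part of)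
Theorem 4.12 and descent arguments (see [JSW] for details)"), kernel-checked at statement level.
[cite: YanZhu2024MainConjNonCM, Thm. 4.9, Thm. 4.12, Thm. 4.15 and its proof (§4.6)]
[cite: JetchevSkinnerWan2017, Thm. 3.3.1, §7.4.1] [cite: CastellaGrossiLeeSkinner2022, Thm. 5.1.3]
[cite: Wuthrich2014, Lemma 20 (p. 399)] [cite: Miller2011LMS, Def. 1.1] -/
theorem RowC16.bsdp_of_yzThm49_of_thm331_of_thm412
    (hGZ : ∀ (N : ℕ) [NeZero N] (W : WeierstrassCurve ℚ) (K : Type) [Field K] [NumberField K],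
      gross_zagier N W K)
    (hKo : ∀ (N : ℕ) [NeZero N] (W : WeierstrassCurve ℚ) (K : Type) [Field K] [NumberField K],
      kolyvagin N W K)
    (hB : ∀ (N : ℕ) [NeZero N] (W : WeierstrassCurve ℚ) (K : Type) [Field K] [NumberField K],
      Kolyvagin1990_padicValNat_card_sha_le N W K)
    (hYZ : thm49_charIdeal_eq_padicLFunction_integral)
    (hW20 : Wuthrich2014.lemma20_surjective_threeAdic_of_semistable)
    (h331 : thm331_anticyclotomicControl) (h412 : thm412_thm513_generator_constantCoeff)
    (hGr : greenberg_charValue_rankZero) (hGZK : rank_eq_analyticRank_of_analyticRank_le_one)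
    (hmod : hasEntireLFunction_rat) (hpar : nonempty_modularParametrizationData)
    (hnf : exists_isNewformOf) (hHL : HoffsteinLuo1997_exists_twist_L_one_ne_zero)
    (hMaz : mazur_not_dvd_maninConstant_of_odd) (hNS : integral_neronScaling_of_isGloballyMinimal)
    (h : RowC16 W p) (hr : W.analyticRank ≤ 1)
    (htam0 : W.analyticRank = 1 → ¬ p ∣ W.tamagawaProduct)
    (hIrrK : W.analyticRank = 1 → ∀ (K : Type) [Field K] [NumberField K], IsImaginaryQuadratic K →
      SatisfiesHeegnerHypothesis (W.conductorNorm ℤ) K → SatisfiesHeegnerHypothesis p K →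
      (W.baseChange K).HasIrreducibleModPGaloisRep p) :
    BSDp W p := by
  refine RowC16.bsdp_of_yzThm49_of_thm331 hGZ hKo hB hYZ hW20 h331 hGr hGZK hmod hpar hnf hHL hMaz hNS
    h hr htam0 hIrrK ?_
  intro hr1 N _ K _ _ Dt H ιC P hN hK hodd hlt hHN hHp _ hP hc hPinf κ hκ γ _ ι
  obtain ⟨hp3, hord, hirr, hsr⟩ := h
  subst hp3
  have hsurj : Surj W 3 := hsr.elim id fun hram ↦ surj_of_irr_of_ram W 3 hirr hram
  have hHN' : SatisfiesHeegnerHypothesis (W.conductorNorm ℤ) K := by rw [hN]; exact hHN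
  exact X11b.imcLowerWaldspurgerOnTreeGoodAt_inducedPlace_of_heegner_of_thm412_of_thm331 W 3 N K Dt H
    ιC P h412 h331 (hKo N W K) le_rfl hord (X9.bigIm_three_of_surj W hW20 (Or.inl hord.1) hsurj)
    (hIrrK hr1 K hK hHN' hHp) hN hK hodd hlt hHN hHp hP hc hPinf hκ ι

/-- **Row C3 at every prime of the row, the whole ORDINARY branch from NAMED LITERATURE FACTS** (+
(irr_K), + `p ∤ ∏c_ℓ`): gen 6 File G2's `RowC3.bsdp_of_thm331_of_thm124b_of_columnMainConjectures`
(ordinary `p ≥ 5`: BCS 1.1.2 (b) + BCS 1.2.4 (b) ∘ CGLS 5.1.3 + JSW 3.3.1) with its last typed binder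
on the ordinary branch, `hLA3` (ordinary `p = 3`), DISCHARGED by Yan–Zhu 2026 Thm. 4.12 ∘ CGLS 2022
Thm. 5.1.3 (`h412`; (Im) at `3` from surj(3) — Diamond's refined Serre `RowC3.surj` — by Wuthrich
2014 Lemma 20 `hW20`). Supersingular branch unchanged: the typed Kobayashi signed main conjecture
(`hKMC`, OPEN in print off CM / `a_p = 0`) + BKO 2024 Cor. A.5 (`hA5`). So on ITS ORDINARY SUB-LOCUS
row C3 (= JSW 2017 Thm. 1.2.1) is now, at EVERY prime of the row, "cyclotomic IMC (published) +
anticyclotomic IMC ∘ BDP (published) + control (published) + GZ + Kolyvagin + GZK + … ⇒ BSD_p", modulo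
the explicit binders `hIrrK` and `htam0`.
[cite: JetchevSkinnerWan2017, Thm. 1.2.1, Thm. 3.3.1] [cite: BurungaleCastellaSkinner2025, Thm. 1.1.2 (b), Thm. 1.2.4 (b)]
[cite: YanZhu2024MainConjNonCM, Thm. 4.9, Thm. 4.12] [cite: CastellaGrossiLeeSkinner2022, Thm. 5.1.3]
[cite: BurungaleKobayashiOta2023, App. A Cor. A.5] [cite: Wuthrich2014, Lemma 20 (p. 399)] -/
theorem RowC3.bsdp_of_thm331_of_bdpFacts_of_columnMainConjectures
    (hGZ : ∀ (N : ℕ) [NeZero N] (W : WeierstrassCurve ℚ) (K : Type) [Field K] [NumberField K],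
      gross_zagier N W K)
    (hKo : ∀ (N : ℕ) [NeZero N] (W : WeierstrassCurve ℚ) (K : Type) [Field K] [NumberField K],
      kolyvagin N W K)
    (hB : ∀ (N : ℕ) [NeZero N] (W : WeierstrassCurve ℚ) (K : Type) [Field K] [NumberField K],
      Kolyvagin1990_padicValNat_card_sha_le N W K)
    (hBCS : thm112b_charIdeal_eq_padicLFunction_integral)
    (hYZ : thm49_charIdeal_eq_padicLFunction_integral)
    (hW20 : Wuthrich2014.lemma20_surjective_threeAdic_of_semistable)
    (h331 : thm331_anticyclotomicControl) (h124 : thm124b_thm513_generator_constantCoeff)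
    (h412 : thm412_thm513_generator_constantCoeff)
    (hA5 : corA5_pPart_of_signedCharIdeal_eq)
    (hGr : greenberg_charValue_rankZero) (hGZK : rank_eq_analyticRank_of_analyticRank_le_one)
    (hmod : hasEntireLFunction_rat) (hpar : nonempty_modularParametrizationData)
    (hnf : exists_isNewformOf) (hLL : diamond1995_refinedSerre)
    (hHL : HoffsteinLuo1997_exists_twist_L_one_ne_zero)
    (hMaz : mazur_not_dvd_maninConstant_of_odd) (hNS : integral_neronScaling_of_isGloballyMinimal)
    (h : RowC3 W p)
    (htam0 : GoodOrd W p → ¬ p ∣ W.tamagawaProduct)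
    (ε : ℤˣ) (hKMC : (p : ℤ) ∣ W.frobeniusTrace p → Supersingular.KobayashiMainConjecture W p ε)
    (hIrrK : GoodOrd W p → ∀ (K : Type) [Field K] [NumberField K], IsImaginaryQuadratic K →
      SatisfiesHeegnerHypothesis (W.conductorNorm ℤ) K → SatisfiesHeegnerHypothesis p K →
      (W.baseChange K).HasIrreducibleModPGaloisRep p) :
    BSDp W p := by
  refine RowC3.bsdp_of_thm331_of_thm124b_of_columnMainConjectures W p hGZ hKo hB hBCS hYZ hW20 h331 h124
    hA5 hGr hGZK hmod hpar hnf hLL hHL hMaz hNS h htam0 ε hKMC hIrrK ?_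
  intro h3 hord N _ K _ _ Dt H ιC P hN hK hodd hlt hHN hHp _ hP hc hPinf κ hκ γ _ ι
  have hsurj : Surj W p := RowC3.surj hnf hLL h
  subst h3
  have hHN' : SatisfiesHeegnerHypothesis (W.conductorNorm ℤ) K := by rw [hN]; exact hHN
  exact X11b.imcLowerWaldspurgerOnTreeGoodAt_inducedPlace_of_heegner_of_thm412_of_thm331 W 3 N K Dt H
    ιC P h412 h331 (hKo N W K) le_rfl hord (X9.bigIm_three_of_surj W hW20 (Or.inl hord.1) hsurj)
    (hIrrK hord K hK hHN' hHp) hN hK hodd hlt hHN hHp hP hc hPinf hκ ι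

end Rows

end Summit.BirchSwinnertonDyer.Rank1Residual

end
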